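import Mathlib
import Literature.Analysis.FluidPDE.SpaceTimeRescaling
import HarnessLib

/-!
# Shelf 1574, birth line: the self-similar envelope integrates to Leray's rate
# (`stub_cellIntegral` of `Cruxes/EnstrophyQuarterLaw/Lines/birth.lean`)

Helper file (`--supports stmt-NavierStokesRegularity-1574 --as helper`). Stub 3 of the BC3 birth skeleton of the crux
`EnstrophyQuarterLaw` (registrar planner-skel-stmt-NavierStokesRegularity-1574-0, 2026-08-17), signature VERBATIM:
there is an absolute `c₀ > 0` with

  `∫⁻_{ℝ³} A / ((s + |x − x₀|²)²) dx ≤ c₀ A / √s`   for all centres `x₀`, all `s > 0`, `A ≥ 0`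

(exact value `π² A/√s`). Pure measure theory — translate to `x₀ = 0`, scale `x = √s·y`
(`lintegral_comp_space_affine`: `∫⁻ F(x₀ + γy) dy = γ⁻³ ∫⁻ F`), and `A/((s + s|y|²)²) = (A/s²)(1 + |y|²)⁻²` with
`∫_{ℝ³} (1 + |y|²)⁻² dy < ∞` (Mathlib `integrable_rpow_neg_one_add_norm_sq`, exponent `4 > 3 = dim`); we take
`c₀ := I + 1` with `I` that integral. This is where the exponent `½` of the quarter law comes from in the birth
line (dimension `3` minus envelope degree `4`, halved). The line's heart `stub_typeICells` (quantisation of a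
Type-I blow-up into finitely many self-similar cells) and `stub_noTypeII` (0056) stay OPEN; nothing here bears on
the regularity problem. No summit statement is proved.
-/

noncomputable section

-- the summit-side namespace repeats a component by design (D-0017)
set_option linter.dupNamespace false

namespace Summit.NavierStokesRegularity.NavierStokesRegularity.Theorems.EnstrophyQuarterLaw.Birth

open Set MeasureTheory Filter Topology Module
open scoped ENNReal NNReal
open Literature.Analysis.FluidPDE

/-- **`stub_cellIntegral` of `Lines/birth.lean` (signature verbatim): the self-similar vorticity envelope
`A/((s + |x − x₀|²)²)` has integral `≤ c₀ A/√s` over `ℝ³`, `c₀` absolute** (translation + scaling of Lebesgue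
measure; `∫(1+|y|²)⁻² dy < ∞` in dimension three). [folklore] -/
theorem cellIntegral :
    ∃ c₀ : ℝ, 0 < c₀ ∧ ∀ (x₀ : EuclideanSpace ℝ (Fin 3)) (s A : ℝ), 0 < s → 0 ≤ A →
      ∫⁻ x, ENNReal.ofReal (A / ((s + ‖x - x₀‖ ^ 2) ^ 2)) ≤
        ENNReal.ofReal (c₀ * A / Real.sqrt s) := by
  -- the profile integral `I = ∫ (1+|y|²)^{-2} dy < ∞` on `ℝ³`
  set I : ℝ≥0∞ := ∫⁻ y : EuclideanSpace ℝ (Fin 3), ENNReal.ofReal ((1 + ‖y‖ ^ 2) ^ (-(4 : ℝ) / 2)) with hI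
  have hIfin : I < ⊤ := by
    have hint : Integrable (fun y : EuclideanSpace ℝ (Fin 3) => ((1 : ℝ) + ‖y‖ ^ 2) ^ (-(4 : ℝ) / 2))
        (volume : Measure (EuclideanSpace ℝ (Fin 3))) :=
      integrable_rpow_neg_one_add_norm_sq (by rw [finrank_euclideanSpace_fin]; norm_num)
    have h2 := (hasFiniteIntegral_iff_enorm).1 hint.2
    refine lt_of_le_of_lt (le_of_eq (lintegral_congr fun y => ?_)) h2
    rw [Real.enorm_eq_ofReal (Real.rpow_nonneg (by positivity) _)]
  refine ⟨I.toReal + 1, by positivity, fun x₀ s A hs hA => ?_⟩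
  have hγ : 0 < Real.sqrt s := Real.sqrt_pos.2 hs
  set F : EuclideanSpace ℝ (Fin 3) → ℝ≥0∞ := fun x => ENNReal.ofReal (A / ((s + ‖x - x₀‖ ^ 2) ^ 2)) with hF
  -- change of variables `x = x₀ + √s • y`
  have hcv : ∫⁻ x, F x = ENNReal.ofReal (Real.sqrt s ^ 3) * ∫⁻ y, F (x₀ + Real.sqrt s • y) := by
    have h := lintegral_comp_space_affine hγ x₀ F
    rw [finrank_euclideanSpace_fin] at h
    have hne : ENNReal.ofReal (Real.sqrt s ^ 3) ≠ 0 := (ENNReal.ofReal_pos.2 (by positivity)).ne'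
    rw [ENNReal.ofReal_inv_of_pos (by positivity)] at h
    rw [h, ← mul_assoc, ENNReal.mul_inv_cancel hne ENNReal.ofReal_ne_top, one_mul]
  -- the rescaled integrand is `(A/s²) (1+|y|²)^{-2}`
  have hpt : ∀ y : EuclideanSpace ℝ (Fin 3), F (x₀ + Real.sqrt s • y) =
      ENNReal.ofReal (A / s ^ 2) * ENNReal.ofReal ((1 + ‖y‖ ^ 2) ^ (-(4 : ℝ) / 2)) := by
    intro y
    rw [hF]
    dsimp only
    rw [add_sub_cancel_left, norm_smul, Real.norm_of_nonneg hγ.le, mul_pow, Real.sq_sqrt hs.le,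
      ← ENNReal.ofReal_mul (by positivity)]
    congr 1
    have h1 : (1 + ‖y‖ ^ 2) ^ (-(4 : ℝ) / 2) = ((1 + ‖y‖ ^ 2) ^ 2)⁻¹ := by
      rw [show (-(4 : ℝ) / 2) = -((2 : ℕ) : ℝ) by norm_num, Real.rpow_neg (by positivity),
        Real.rpow_natCast]
    rw [h1]
    have hy : 0 < 1 + ‖y‖ ^ 2 := by positivity
    field_simp
  change ∫⁻ x, F x ≤ _
  rw [hcv, lintegral_congr hpt, lintegral_const_mul' _ _ ENNReal.ofReal_ne_top, ← hI]
  -- `√s³ · (A/s²) · I ≤ (I + 1) A/√s`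
  have h4 : Real.sqrt s ^ 4 = s ^ 2 := by
    rw [show (4 : ℕ) = 2 * 2 from rfl, pow_mul, Real.sq_sqrt hs.le]
  have hs3 : Real.sqrt s ^ 3 * (A / s ^ 2) = A / Real.sqrt s := by
    rw [← h4]
    field_simp
  have hI0 : 0 ≤ I.toReal := ENNReal.toReal_nonneg
  have hAs : 0 ≤ A / Real.sqrt s := div_nonneg hA hγ.le
  calc ENNReal.ofReal (Real.sqrt s ^ 3) * (ENNReal.ofReal (A / s ^ 2) * I)
      = ENNReal.ofReal (Real.sqrt s ^ 3) * (ENNReal.ofReal (A / s ^ 2) * ENNReal.ofReal I.toReal) := by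
        rw [ENNReal.ofReal_toReal hIfin.ne]
    _ = ENNReal.ofReal (A / Real.sqrt s * I.toReal) := by
        rw [← ENNReal.ofReal_mul (by positivity), ← ENNReal.ofReal_mul (by positivity), ← mul_assoc, hs3]
    _ ≤ ENNReal.ofReal ((I.toReal + 1) * A / Real.sqrt s) := by
        apply ENNReal.ofReal_le_ofReal
        calc A / Real.sqrt s * I.toReal ≤ A / Real.sqrt s * (I.toReal + 1) :=
              mul_le_mul_of_nonneg_left (by linarith) hAs
          _ = (I.toReal + 1) * A / Real.sqrt s := by ring

end Summit.NavierStokesRegularity.NavierStokesRegularity.Theorems.EnstrophyQuarterLaw.Birth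

end
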